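import Summits.BirchSwinnertonDyer.BirchSwinnertonDyer.Theorems.CyclotomicUntwistPrimePowerGaussSum
import Mathlib.RingTheory.RootsOfUnity.AlgebraicallyClosed
import HarnessLib

/-!
# The untwisting identity at the BOTTOM level `pⁿ = p^c`: a JACOBI sum —
# `untwistSymbolSum p f η χ = J(χ, η) · ratTwistedSymbolSum f (χη)`, `J(χ,η) = ∑_a χ(a) η(1 − a)`,
# with `g(χ)g(η) = J(χ,η) g(χη)` over `ℤ/p^c` and `J(χ, η) ≠ 0`

Cell `pub/bsd-wall` (D-0145 line `route-BirchSwinnertonDyer-CyclotomicUntwist`), seat `bsd-line-cycu-p1`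
(prover seat 1/3, K1 base), helper toward crux K1 `PSRankOneLowerHalfAtThree`
(stmt-BirchSwinnertonDyer-21580). THEOREMS ONLY (no definition, no named fact, no `sorry`); BSD is not
proved by this file and no crux is.

Completes the reduction of D1's interpolation values (`Literature.NumberTheory.IwasawaTheory.
IsUntwistedPAdicLFunction`) to ORDINARY twisted symbol sums of `f`: levels `pⁿ ≥ p^{2c}` are
`CyclotomicUntwistUntwistingIdentity` (Gauss sum), levels `p^c < pⁿ < p^{2c}` are
`CyclotomicUntwistUntwistingIdentityAllLevels` (the sum `J_n`), and THIS file treats `n = c` — on the route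
(`p = 3`, `c = 2`) the two even characters `ξ` of conductor `9`, for which `χ = η̄ξ` has conductor `9`:

* §1 the inner sums `I(y) = ∑_a χ(a) η(y − a)`: `I(u) = (χη)(u) · J(χ,η)` at a unit (`a ↦ ua`), and
  `I(y) = 0` at a non-unit when `χη` is PRIMITIVE mod `p^c` (`c ≥ 1`; `a ↦ ua` for a unit `u ≡ 1 (p^{c−1})`
  with `(χη)(u) ≠ 1` and `yu = y`, `PSPrimePowerGauss`);
* §2 `untwistSymbolSum_eq_jacobi`: for `χ`, `η` mod `p^c` with `χη` primitive,
  `∑_{a,b mod p^c} χ(a)η(b)[(a+b)/p^c]⁺_f = J(χ,η) · ∑_y (χη)(y)[y/p^c]⁺_f`;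
* §3 `gaussSum_mul_gaussSum_eq_jacobi_mul`: `g(χ,ψ) g(η,ψ) = J(χ,η) g(χη,ψ)` for every additive `ψ` (same
  inner sums) — Mathlib's `JacobiSum` file is for finite FIELDS; `ℤ/9` is not one;
* §4 `jacobi_ne_zero`: `J(χ,η) ≠ 0` when `χ`, `η`, `χη` are all primitive mod `p^c` (`c ≥ 1`): take a primitive
  `p^c`-th root of unity in `ℂ_p` (`HasEnoughRootsOfUnity`, `AddChar.zmodChar`), so a primitive `ψ`, and use
  `g(χ,ψ), g(η,ψ) ≠ 0` (`PSPrimePowerGauss.gaussSum_ne_zero_of_isPrimitive`);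
* §5 `gammaCharValue_eq_jacobi`: for `μ` with the D1 property, `ξ` primitive even of `p`-power order mod
  `p^c` and `χ` primitive mod `p^c` agreeing with `η⁻¹ξ` off `p`:
  `∫_Γ ξ dμ = e_c(α) · J(χ, η) · ∑_{a mod p^c} ξ(a)[a/p^c]⁺_f`, and `J(χ,η) ≠ 0` if `η` is primitive too.

References: [cite: MazurTateTeitelbaum1986Invent, §I.8 (8.6) and §I.14 (case p ∣ N)]; Jacobi sums
modulo prime powers [folklore].
-/

noncomputable section

open scoped MatrixGroups

open CongruenceSubgroup DirichletCharacter Literature.NumberTheory.EllipticCurves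
  Literature.NumberTheory.EllipticCurves.ModularForms Literature.NumberTheory.IwasawaTheory
  Summit.BirchSwinnertonDyer.BirchSwinnertonDyer.Theorems.PSUntwisting
  Summit.BirchSwinnertonDyer.BirchSwinnertonDyer.Theorems.PSPrimePowerGauss

-- single-conjunct summit: `Summit.BirchSwinnertonDyer.BirchSwinnertonDyer.…` repeats the name by design
set_option linter.dupNamespace false
set_option autoImplicit false

namespace Summit.BirchSwinnertonDyer.BirchSwinnertonDyer.Theorems.PSUntwistingJacobi

variable {p : ℕ} [Fact p.Prime]

/-! ### §1 The inner sums `∑_a χ(a) η(y − a)` -/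

section Inner

variable {c : ℕ} (χ η : DirichletCharacter ℂ_[p] (p ^ c))

/-- At a unit: `∑_a χ(a) η(u − a) = (χη)(u) · J(χ, η)` (re-index `a ↦ ua`). [folklore] -/
theorem inner_jacobi_of_isUnit (u : (ZMod (p ^ c))ˣ) :
    ∑ a : ZMod (p ^ c), χ a * η ((u : ZMod (p ^ c)) - a) =
      (χ * η) u * ∑ a : ZMod (p ^ c), χ a * η (1 - a) := by
  rw [MulChar.mul_apply, Finset.mul_sum]
  refine (Fintype.sum_bijective (fun a : ZMod (p ^ c) ↦ (u : ZMod (p ^ c)) * a)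
    (Units.mulLeft_bijective u) _ _ fun a ↦ ?_).symm
  rw [show (u : ZMod (p ^ c)) - (u : ZMod (p ^ c)) * a = (u : ZMod (p ^ c)) * (1 - a) by ring,
    map_mul, map_mul]
  ring

/-- At a NON-unit, for `χη` primitive mod `p^c` (`c ≥ 1`): `∑_a χ(a) η(y − a) = 0` (re-index `a ↦ ua` for a
unit `u ≡ 1 (mod p^{c−1})` with `(χη)(u) ≠ 1`; `yu = y`). [folklore] -/
theorem inner_jacobi_of_not_isUnit (hc : 0 < c) (hprim : (χ * η).IsPrimitive) {y : ZMod (p ^ c)}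
    (hy : ¬ IsUnit y) : ∑ a : ZMod (p ^ c), χ a * η (y - a) = 0 := by
  obtain ⟨u, hu, hne⟩ := exists_unitsMap_eq_one_apply_ne_one (χ * η) hc hprim
  have hyu : y * u = y := mul_eq_self_of_not_isUnit hc hu hy
  set S := ∑ a : ZMod (p ^ c), χ a * η (y - a) with hS
  have hfix : S = (χ * η) u * S := by
    rw [hS, Finset.mul_sum]
    refine (Fintype.sum_bijective (fun a : ZMod (p ^ c) ↦ (u : ZMod (p ^ c)) * a)
      (Units.mulLeft_bijective u) _ _ fun a ↦ ?_).symm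
    have hya : y - (u : ZMod (p ^ c)) * a = (u : ZMod (p ^ c)) * (y - a) := by
      rw [mul_sub, mul_comm _ y, hyu]
    rw [hya, map_mul, map_mul, MulChar.mul_apply]
    ring
  have h0 : ((χ * η) u - 1) * S = 0 := by linear_combination -hfix
  exact (mul_eq_zero.mp h0).resolve_left (sub_ne_zero.mpr hne)

/-- Both cases at once: `∑_a χ(a) η(y − a) = (χη)(y) · J(χ,η)` for every `y` (`χη` primitive, `c ≥ 1`).
[folklore] -/
theorem inner_jacobi_eq (hc : 0 < c) (hprim : (χ * η).IsPrimitive) (y : ZMod (p ^ c)) :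
    ∑ a : ZMod (p ^ c), χ a * η (y - a) = (χ * η) y * ∑ a : ZMod (p ^ c), χ a * η (1 - a) := by
  by_cases hy : IsUnit y
  · obtain ⟨u, rfl⟩ := hy
    exact inner_jacobi_of_isUnit χ η u
  · rw [inner_jacobi_of_not_isUnit χ η hc hprim hy, MulChar.map_nonunit _ hy, zero_mul]

end Inner

/-! ### §2 The untwisting identity at level `p^c`: a Jacobi sum -/

section Identity

variable {N : ℕ} [NeZero N] (f : CuspForm (Gamma0 N) 2)
variable {c : ℕ} (η χ : DirichletCharacter ℂ_[p] (p ^ c))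

/-- **THE UNTWISTING IDENTITY AT THE BOTTOM LEVEL `n = c`.** For Dirichlet characters `η`, `χ` mod `p^c`
(`c ≥ 1`) with `χη` PRIMITIVE and any cusp form `f` on `Γ₀(N)`:
`∑_{a mod p^c} ∑_{b mod p^c} χ(a) η(b) [a/p^c + b/p^c]⁺_f = J(χ,η) · ∑_{y mod p^c} (χη)(y) [y/p^c]⁺_f`,
`J(χ,η) = ∑_a χ(a) η(1 − a)` — i.e. `untwistSymbolSum p f η χ = J(χ,η) · ratTwistedSymbolSum f (χη)`.
[cite: MazurTateTeitelbaum1986Invent, §I.8 (8.6) and §I.14 (case p ∣ N)] -/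
theorem untwistSymbolSum_eq_jacobi (hc : 0 < c) (hprim : (χ * η).IsPrimitive) :
    untwistSymbolSum p f η χ =
      (∑ a : ZMod (p ^ c), χ a * η (1 - a)) * ratTwistedSymbolSum f (χ * η) := by
  haveI : NeZero (p ^ c) := ⟨pow_ne_zero _ (Fact.out : p.Prime).ne_zero⟩
  set A : ZMod (p ^ c) → ℂ_[p] := fun x ↦ algebraMap ℚ ℂ_[p] (ratPlusSymbol f ((x.val : ℚ) / (p : ℚ) ^ c))
    with hA
  -- Step 1: the symbol depends on `a + b`
  have h1 : untwistSymbolSum p f η χ = ∑ a : ZMod (p ^ c), ∑ b : ZMod (p ^ c), χ a * η b * A (a + b) := by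
    unfold untwistSymbolSum
    refine Finset.sum_congr rfl fun a _ ↦ Finset.sum_congr rfl fun b _ ↦ ?_
    rw [ratPlusSymbol_double_eq f le_rfl a b, Nat.sub_self, pow_zero, Nat.cast_one, one_mul,
      ZMod.natCast_zmod_val]
  -- Step 2: re-index `b ↦ y = a + b`, swap, evaluate the inner sums
  have h2 : ∀ a : ZMod (p ^ c), ∑ b : ZMod (p ^ c), χ a * η b * A (a + b) =
      ∑ y : ZMod (p ^ c), χ a * η (y - a) * A y := fun a ↦
    Fintype.sum_equiv (Equiv.addLeft a) _ _ fun b ↦ by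
      simp only [Equiv.coe_addLeft, add_sub_cancel_left]
  rw [h1, Finset.sum_congr rfl fun a _ ↦ h2 a, Finset.sum_comm, ratTwistedSymbolSum, Finset.mul_sum]
  refine Finset.sum_congr rfl fun y _ ↦ ?_
  have hAy : (ratPlusSymbol f ((y.val : ℚ) / ((p ^ c : ℕ) : ℚ)) : ℂ_[p]) = A y := by
    simp only [hA, eq_ratCast, Nat.cast_pow]
  have hinner : ∑ a : ZMod (p ^ c), χ a * η (y - a) * A y = A y * ∑ a : ZMod (p ^ c), χ a * η (y - a) := by
    rw [Finset.mul_sum]; exact Finset.sum_congr rfl fun a _ ↦ by ring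
  rw [hinner, inner_jacobi_eq χ η hc hprim y, hAy]
  ring

end Identity

/-! ### §3 Gauss and Jacobi sums over `ℤ/p^c`: `g(χ) g(η) = J(χ,η) g(χη)` -/

section GaussJacobi

variable {c : ℕ} (χ η : DirichletCharacter ℂ_[p] (p ^ c))

/-- **`g(χ,ψ) · g(η,ψ) = J(χ,η) · g(χη,ψ)`** over `ℤ/p^c` (`c ≥ 1`) for `χη` primitive and any additive
`ψ`: `g(χ)g(η) = ∑_s ψ(s) ∑_x χ(x)η(s − x)` and the inner sums are `(χη)(s) J(χ,η)` (§1). [folklore] -/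
theorem gaussSum_mul_gaussSum_eq_jacobi_mul (hc : 0 < c) (hprim : (χ * η).IsPrimitive)
    (ψ : AddChar (ZMod (p ^ c)) ℂ_[p]) :
    gaussSum χ ψ * gaussSum η ψ = (∑ a : ZMod (p ^ c), χ a * η (1 - a)) * gaussSum (χ * η) ψ := by
  rw [gaussSum, gaussSum, gaussSum, Finset.sum_mul_sum, Finset.mul_sum]
  -- re-index `y ↦ s = x + y`
  have hre : ∀ x : ZMod (p ^ c), ∑ y : ZMod (p ^ c), χ x * ψ x * (η y * ψ y) =
      ∑ s : ZMod (p ^ c), χ x * η (s - x) * ψ s := fun x ↦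
    Fintype.sum_equiv (Equiv.addLeft x) _ _ fun y ↦ by
      simp only [Equiv.coe_addLeft, add_sub_cancel_left]
      rw [AddChar.map_add_eq_mul]
      ring
  rw [Finset.sum_congr rfl fun x _ ↦ hre x, Finset.sum_comm]
  refine Finset.sum_congr rfl fun s _ ↦ ?_
  rw [← Finset.sum_mul, inner_jacobi_eq χ η hc hprim s, MulChar.mul_apply]
  ring

/-- **`J(χ, η) ≠ 0`** for `χ`, `η`, `χη` all primitive mod `p^c` (`c ≥ 1`): with a primitive additive `ψ` of
`ℤ/p^c` into `ℂ_p` (from a primitive `p^c`-th root of unity, `AddChar.zmodChar`), `g(χ,ψ) g(η,ψ) ≠ 0`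
(`PSPrimePowerGauss.gaussSum_ne_zero_of_isPrimitive`) equals `J(χ,η) g(χη,ψ)`. [folklore] -/
theorem jacobi_ne_zero (hc : 0 < c) (hχ : χ.IsPrimitive) (hη : η.IsPrimitive)
    (hprim : (χ * η).IsPrimitive) : ∑ a : ZMod (p ^ c), χ a * η (1 - a) ≠ 0 := by
  have hp : p.Prime := Fact.out
  haveI : NeZero (p ^ c) := ⟨pow_ne_zero _ hp.ne_zero⟩
  haveI : NeZero ((p ^ c : ℕ) : ℂ_[p]) := ⟨Nat.cast_ne_zero.mpr (pow_ne_zero _ hp.ne_zero)⟩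
  obtain ⟨ζ, hζ⟩ := HasEnoughRootsOfUnity.exists_primitiveRoot ℂ_[p] (p ^ c)
  set ψ : AddChar (ZMod (p ^ c)) ℂ_[p] := AddChar.zmodChar (p ^ c) hζ.pow_eq_one with hψ
  have hψprim : ψ.IsPrimitive := AddChar.zmodChar_primitive_of_primitive_root (p ^ c) hζ
  intro hJ
  have h := gaussSum_mul_gaussSum_eq_jacobi_mul χ η hc hprim ψ
  rw [hJ, zero_mul, mul_eq_zero] at h
  rcases h with h | h
  · exact gaussSum_ne_zero_of_isPrimitive χ hc hχ hψprim h
  · exact gaussSum_ne_zero_of_isPrimitive η hc hη hψprim h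

end GaussJacobi

/-! ### §4 Consequence for D1 at conductor `p^c` -/

section Interpolation

variable {N : ℕ} [NeZero N] {f : CuspForm (Gamma0 N) 2}
variable {c : ℕ} {η : DirichletCharacter ℂ_[p] (p ^ c)} {α : ℂ_[p]} {μ : (n : ℕ) → ZMod (p ^ n) → ℂ_[p]}

/-- **D1's interpolation value at conductor `p^c`.** For `μ` with `IsUntwistedPAdicLFunction p f η α μ`
(`c ≥ 1`), `ξ` primitive even of `p`-power order mod `p^c` and `χ` primitive mod `p^c` agreeing with `η⁻¹ξ`
off `p`: `∫_Γ ξ dμ = e_c(α) · J(χ,η) · ∑_{a mod p^c} ξ(a)[a/p^c]⁺_f`. On the route: the two even characters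
of conductor `9`. [cite: MazurTateTeitelbaum1986Invent, §I.14 (case p ∣ N)] -/
theorem gammaCharValue_eq_jacobi (hμ : IsUntwistedPAdicLFunction p f η α μ) (hc : 0 < c)
    (ξ : DirichletCharacter ℂ_[p] (p ^ c)) (hξ : ξ.IsPrimitive) (hξe : ξ.Even)
    (hξo : ∃ j : ℕ, orderOf ξ = p ^ j) (χ : DirichletCharacter ℂ_[p] (p ^ c)) (hχ : χ.IsPrimitive)
    (hcompat : ∀ a : ℕ, a.Coprime p → χ (a : ZMod (p ^ c)) = (η (a : ZMod (p ^ c)))⁻¹ * ξ (a : ZMod (p ^ c))) :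
    gammaCharValue p μ ξ =
      untwistMultiplier p α c * ((∑ a : ZMod (p ^ c), χ a * η (1 - a)) * ratTwistedSymbolSum f ξ) := by
  have hχη : χ * η = ξ := by
    have h := mul_changeLevel_eq_of_compat hc le_rfl χ ξ hcompat
    rwa [changeLevel_self] at h
  have hprim : (χ * η).IsPrimitive := by rw [hχη]; exact hξ
  obtain ⟨-, -, hint⟩ := hμ
  rw [hint c ξ hξ hξe hξo c χ hχ hcompat, untwistSymbolSum_eq_jacobi f η χ hc hprim, hχη]

/-- … and the Jacobi constant there is NON-ZERO when `η` is primitive as well (route: `η` primitive mod `9`).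
[folklore] -/
theorem jacobi_ne_zero_of_compat (hc : 0 < c) (hη : η.IsPrimitive) (ξ : DirichletCharacter ℂ_[p] (p ^ c))
    (hξ : ξ.IsPrimitive) (χ : DirichletCharacter ℂ_[p] (p ^ c)) (hχ : χ.IsPrimitive)
    (hcompat : ∀ a : ℕ, a.Coprime p → χ (a : ZMod (p ^ c)) = (η (a : ZMod (p ^ c)))⁻¹ * ξ (a : ZMod (p ^ c))) :
    ∑ a : ZMod (p ^ c), χ a * η (1 - a) ≠ 0 := by
  have hχη : χ * η = ξ := by
    have h := mul_changeLevel_eq_of_compat hc le_rfl χ ξ hcompat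
    rwa [changeLevel_self] at h
  exact jacobi_ne_zero χ η hc hχ hη (by rw [hχη]; exact hξ)

end Interpolation

end Summit.BirchSwinnertonDyer.BirchSwinnertonDyer.Theorems.PSUntwistingJacobi
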